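import Summits.RiemannHypothesis.RiemannHypothesis.Theorems.ThetaTier2Sound
import HarnessLib

/-!
# THETA tier-2 kernel checker — GLUE between `T2Valid` (K4) and the E-side cross term (rh-explicit-tier2-p2, WEIL typing lane; RH-FREE)

HOME/cc-s2-1/gen22/TIER2-KERNEL-SPEC.md §5 (K4) ↔ weil-1's `WeilColumn.ThetaPrime.sum_vonMangoldt_cross_le` (`WeilColumnThetaCrossTermT2`).
That E4/E5 theorem asks for a cell envelope `e t ≤ envX i` on EVERY depth cell `i : ℕ`, while the kernel's `ThetaTier2.envX A` has only
`Kw + 1` entries (`envX A i = 0` for `i > Kw`) and `T2Valid` supplies envelopes for `i ≤ Kw` only (`envE_le` + `envX_eq` below `Jt`,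
`envX_tail` on `Jt ≤ i ≤ Kw`).  The crack is closed by EXTENDING the sequence with the global bound `Z` of `e` (`e(s) ≤ Z·e^{−κs} ≤ Z`):

* `envExt env Kw Z i := if i ≤ Kw then env i else Z`; for a lag cell `k ≤ Kw` the E4 sum `Σ_{i≤k} env_i·max(env_{k−i−1}, env_{k−i})` is
  unchanged (`lagCellSum_envExt_eq`: all indices are `≤ k`), and `cellEnvelope_envExt` gives the envelope on every cell from the near cells
  (`i < Jt`), the far cells (`Z·e^{−κ iτ} ≤ env i`, `Jt ≤ i ≤ Kw`) and the exponential tail;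
* `T2Valid.cross_hyps` reads weil-1's hypotheses `hH` / `hGs` / `hGs0` / `hanti` and the glue inequality `Gt ≤ Gs Kw` off a certified row
  with `envX := envExt (envX A) Kw z`, `H k := τ·lagSum A k`, `Gs := GsR A`; `T2Valid.cellEnvelope_all` is `henv` for any `e` with
  `e(s) ≤ z·e^{−(m+½)s}` whose near-cell envelopes are the kernel's `envE`.

Nothing here bears on the truth of RH.
-/

set_option linter.dupNamespace false  -- the mandated namespace repeats `RiemannHypothesis`
set_option autoImplicit false

namespace Summit.RiemannHypothesis.RiemannHypothesis.Theorems.ThetaTier2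

open Real Finset

/-! ## The extended envelope sequence -/

/-- Extension of a cell-envelope sequence beyond the lag range `i ≤ Kw` by a constant `Z` (a global bound of the enveloped function).
[this cell, TIER2-KERNEL-SPEC §5 (K4)] -/
noncomputable def envExt (env : ℕ → ℝ) (Kw : ℕ) (Z : ℝ) (i : ℕ) : ℝ := if i ≤ Kw then env i else Z

/-- In range the extension is the sequence. [this cell] -/
theorem envExt_of_le {env : ℕ → ℝ} {Kw : ℕ} {Z : ℝ} {i : ℕ} (h : i ≤ Kw) : envExt env Kw Z i = env i := if_pos h

/-- Beyond the range the extension is the constant. [this cell] -/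
theorem envExt_of_lt {env : ℕ → ℝ} {Kw : ℕ} {Z : ℝ} {i : ℕ} (h : Kw < i) : envExt env Kw Z i = Z := if_neg (not_le.2 h)

/-- The extension of a nonnegative sequence by a nonnegative constant is nonnegative (weil-1's `henv0`). [this cell] -/
theorem envExt_nonneg {env : ℕ → ℝ} {Kw : ℕ} {Z : ℝ} (h0 : ∀ i, 0 ≤ env i) (hZ : 0 ≤ Z) (i : ℕ) : 0 ≤ envExt env Kw Z i := by
  unfold envExt
  split_ifs
  exacts [h0 i, hZ]

/-- **The E4 lag-cell sum is unchanged by the extension** for `k ≤ Kw` (every index `i`, `k − i − 1`, `k − i` is `≤ k`). [this cell] -/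
theorem lagCellSum_envExt_eq {env : ℕ → ℝ} {Kw : ℕ} {Z : ℝ} {k : ℕ} (hk : k ≤ Kw) :
    ∑ i ∈ range (k + 1), envExt env Kw Z i * max (envExt env Kw Z (k - i - 1)) (envExt env Kw Z (k - i)) =
      ∑ i ∈ range (k + 1), env i * max (env (k - i - 1)) (env (k - i)) := by
  refine sum_congr rfl fun i hi => ?_
  have hi' : i ≤ k := Nat.lt_succ_iff.1 (mem_range.1 hi)
  rw [envExt_of_le (le_trans hi' hk), envExt_of_le (by omega), envExt_of_le (by omega)]

/-- **An envelope on EVERY cell.** If `e(s) ≤ Z·e^{−κs}` for `s ≥ 0` (`Z, κ, τ ≥ 0`), `e ≤ env i` on the near cells `i < Jt`, and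
`Z·e^{−κ iτ} ≤ env i` on the far cells `Jt ≤ i ≤ Kw`, then `e ≤ envExt env Kw Z i` on the closed cell `[iτ, (i+1)τ]` for every `i : ℕ`
(weil-1's `henv`). [this cell, TIER2-KERNEL-SPEC §2 (E4)] -/
theorem cellEnvelope_envExt {τ Z κ : ℝ} {e : ℝ → ℝ} {env : ℕ → ℝ} {Jt Kw : ℕ} (hτ : 0 ≤ τ) (hZ : 0 ≤ Z) (hκ : 0 ≤ κ)
    (hexp : ∀ s : ℝ, 0 ≤ s → e s ≤ Z * exp (-κ * s))
    (hnear : ∀ i < Jt, ∀ t : ℝ, (i : ℝ) * τ ≤ t → t ≤ ((i : ℝ) + 1) * τ → e t ≤ env i)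
    (hfar : ∀ i : ℕ, Jt ≤ i → i ≤ Kw → Z * exp (-κ * ((i : ℝ) * τ)) ≤ env i) :
    ∀ (i : ℕ) (t : ℝ), (i : ℝ) * τ ≤ t → t ≤ ((i : ℝ) + 1) * τ → e t ≤ envExt env Kw Z i := by
  intro i t h1 h2
  have hi0 : 0 ≤ (i : ℝ) * τ := mul_nonneg (Nat.cast_nonneg i) hτ
  have ht0 : 0 ≤ t := hi0.trans h1
  rcases le_or_gt i Kw with hi | hi
  · rw [envExt_of_le hi]
    rcases lt_or_ge i Jt with hij | hij
    · exact hnear i hij t h1 h2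
    · refine (hexp t ht0).trans (le_trans ?_ (hfar i hij hi))
      have hle : -κ * t ≤ -κ * ((i : ℝ) * τ) := by nlinarith
      exact mul_le_mul_of_nonneg_left (exp_le_exp.2 hle) hZ
  · rw [envExt_of_lt hi]
    refine (hexp t ht0).trans ?_
    have h1' : exp (-κ * t) ≤ 1 := exp_le_one_iff.2 (by nlinarith)
    calc Z * exp (-κ * t) ≤ Z * 1 := mul_le_mul_of_nonneg_left h1' hZ
      _ = Z := mul_one Z

/-! ## Reading weil-1's cross-term hypotheses off `T2Valid` -/

/-- **`henv` for a certified row**: any `e` with `e(s) ≤ z·e^{−(m+½)s}` (`s ≥ 0`) whose near-cell envelopes are the kernel's `envE A j`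
(`j < Jt`) is enveloped on EVERY cell by `envExt (envX A) Kw z` (`τ, z ≥ 0`). [this cell, TIER2-KERNEL-SPEC §5 (K1)/(K4)] -/
theorem T2Valid.cellEnvelope_all {A : Inp} {X : RealAtoms} (hV : T2Valid A X) (hτ : 0 ≤ X.τ) (hz : 0 ≤ X.z)
    {e : ℝ → ℝ} (hexp : ∀ s : ℝ, 0 ≤ s → e s ≤ X.z * exp (-(A.m + 1 / 2 : ℝ) * s))
    (hnear : ∀ j < A.Jt, ∀ t : ℝ, (j : ℝ) * X.τ ≤ t → t ≤ ((j : ℝ) + 1) * X.τ → e t ≤ envE A j) :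
    ∀ (i : ℕ) (t : ℝ), (i : ℝ) * X.τ ≤ t → t ≤ ((i : ℝ) + 1) * X.τ → e t ≤ envExt (envX A) A.Kw X.z i :=
  cellEnvelope_envExt hτ hz (by positivity) hexp
    (fun i hi t h1 h2 => (hV.envX_eq i hi).symm ▸ hnear i hi t h1 h2) hV.envX_tail

/-- `henv0` for a certified row: the extended kernel envelope is nonnegative (`z ≥ 0`). [this cell] -/
theorem envExt_envX_nonneg (A : Inp) {z : ℝ} (hz : 0 ≤ z) (i : ℕ) : 0 ≤ envExt (envX A) A.Kw z i :=
  envExt_nonneg (envX_nonneg A) hz i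

/-- **The (K4) kernel hypotheses of `sum_vonMangoldt_cross_le` for a certified row**, with `envX := envExt (envX A) Kw z`,
`H k := τ·lagSum A k`, `Gs := GsR A`: `hH` (as an equality of the lag sums, hence `≤`), `hGs` (`H_k·e^{−kτ/2} ≤ Gs_k`), `hGs0`, `hanti`,
and the glue end `Gt ≤ Gs Kw` (the E-side supplies `z²W_l e^{−(m+1)W_l} ≤ Gt`). [this cell, TIER2-KERNEL-SPEC §5 (K4); THETA-CERT-cc6 E4/E5] -/
theorem T2Valid.cross_hyps {A : Inp} {X : RealAtoms} (hV : T2Valid A X) :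
    (∀ k < A.Kw, X.τ * ∑ i ∈ range (k + 1), envExt (envX A) A.Kw X.z i *
        max (envExt (envX A) A.Kw X.z (k - i - 1)) (envExt (envX A) A.Kw X.z (k - i)) ≤ X.τ * lagSum A k) ∧
    (∀ k < A.Kw, X.τ * lagSum A k * exp (-((k : ℝ) * X.τ) / 2) ≤ GsR A k) ∧
    (∀ k, 0 ≤ GsR A k) ∧
    (∀ k, k + 1 ≤ A.Kw → GsR A (k + 1) ≤ GsR A k) ∧
    X.Gt ≤ GsR A A.Kw := by
  refine ⟨fun k hk => ?_, fun k hk => ?_, GsR_nonneg A, fun k _ => hV.GsR_succ_le k, hV.Gt_le_GsR A.Kw⟩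
  · unfold lagSum
    rw [lagCellSum_envExt_eq hk.le]
  · have h := hV.GsR_cell k hk ((k : ℝ) * X.τ) le_rfl
    calc X.τ * lagSum A k * exp (-((k : ℝ) * X.τ) / 2)
        = exp (-(1 / 2 : ℝ) * ((k : ℝ) * X.τ)) * (X.τ * lagSum A k) := by
          rw [mul_comm]; congr 1; congr 1; ring
      _ ≤ GsR A k := h

/-- **The (K4) sum is the kernel's**: for `k < Kw` the E4 bracket of the extended envelope IS `lagSum A k`. [this cell] -/
theorem lagCellSum_envExt_envX (A : Inp) (z : ℝ) {k : ℕ} (hk : k < A.Kw) :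
    ∑ i ∈ range (k + 1), envExt (envX A) A.Kw z i *
        max (envExt (envX A) A.Kw z (k - i - 1)) (envExt (envX A) A.Kw z (k - i)) = lagSum A k := by
  unfold lagSum
  exact lagCellSum_envExt_eq hk.le

end Summit.RiemannHypothesis.RiemannHypothesis.Theorems.ThetaTier2
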